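import Literature.Computability.AlgebraicComplexity.PlethysmLengthVanishing
import Literature.Computability.AlgebraicComplexity.PlethysmFirstRowVanishing
import Literature.Computability.AlgebraicComplexity.Polarization
import Literature.Computability.AlgebraicComplexity.OrbitMultiplicitySemigroup
import Literature.Computability.AlgebraicComplexity.StandardFamilies

/-!
# Route GeneratorObstructions — K1 `PerGenDegreeSuperQP` (stmt-ValiantsHypothesis-11654),
# line `per-side-atoms`: ATOM CERTIFICATES for the occurrence monoid (support toward `stub_atomLate`)

Registered line `Cruxes/GenFlipThesis/Lines/per_side_atoms.lean`: K1 follows from `stub_atomGen`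
(LANDED, `GeneratorObstructionsPerGenDegreeSuperQPAtomGen.lean`) and `stub_atomLate` — for every
`c, m₀` some `m ≥ m₀` carries a weight `χ` OCCURRING in `ℂ[Δ_m[per_m]]` (`HWV_χ ≠ ⊥`) which is an
ATOM of the occurrence monoid `S(per_m) = {χ : HWV_χ ≠ ⊥}` (no splitting `χ = χ₁ + χ₂` into two
nonzero occurring weights) of degree `-|χ|/m > 2^((log₂ m + c)^c)`.

This support file (no definitions, Literature imports only) supplies the elementary structure
theory of atoms that the line needs, for an arbitrary form `f` of degree `n ≠ 0` on the
lexicographic matrix variables `MatIdx m`, and reads it for the permanent: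

1. occurring weights are dominant and `≤ 0` (tree, BLMW (5.2.2)), so their supports are NESTED
   upper sets (`filter_ne_zero_subset_or`, `card_filter_add_ne_zero_le_max`);
2. `card_filter_ne_zero_le_degree` — **`ℓ(χ) ≤ deg χ`**: an occurring weight of degree `D` has at
   most `D` nonzero entries (the tree's plethysm length bound `a_λ(d[n]) = 0` for `ℓ(λ) > d`,
   Macdonald I.8 Ex. 9, after the BLMW lift `ℂ[Δ_n[f]] ← ℂ[Sym^n]`);
   `le_neg_apply_top_of_occurs` — **`λ₁ ≥ n`** for nonzero occurring weights (GIP 2017 Prop. 13);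
3. two ATOM CERTIFICATES, each a sufficient condition for the atom clause of `stub_atomLate`
   requiring NO knowledge of the rest of the monoid:
   `atom_of_degree_le_card` (**full length**: `#supp χ ≥ deg χ`) and
   `atom_of_neg_apply_top_lt` (**short first row**: `λ₁ < 2n`);
4. their honest CAPS: a full-length weight has degree `≤ m²` (`neg_size_le_of_degree_le_card`) and
   a short-first-row occurring weight has degree `< 2m²` (`neg_size_lt_of_neg_apply_top_lt`) —
   both certificates live at POLYNOMIAL degree, whereas `stub_atomLate` at `c ≥ 2` asks for atoms
   of super-quasi-polynomial degree; they can serve the instances `c ∈ {0, 1}` only;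
5. for `per_m` (`1 ≤ m`): the certificates in the stub's exact vocabulary
   (`per_atom_of_degree_le_card`, `per_atom_of_neg_apply_top_lt`) and
   `per_exists_atom_degree_one` — the weight `-m·ε_top` occurs (BIP §6(a), tree
   `hasHighestWeight_orbitCoordRep_single_top`) and is an atom: the occurrence and atom clauses
   of `stub_atomLate` hold jointly at EVERY `m`, in degree `1`; all content of the stub is its
   degree clause.

Honest framing: structure lemmas about highest-weight vectors of orbit-closure coordinate rings;
`stub_atomLate`, K1 and `GenFlipThesis` remain OPEN; nothing here bears on VP versus VNP.
References: [Macdonald1995] I.8 Ex. 9; [GesmundoIkenmeyerPanova2017] Prop. 13; [BurgisserEtAl2011]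
§4.4, (5.2.2); [BurgisserIkenmeyerPanovaJAMS2019] §6(a).
-/

set_option linter.dupNamespace false

noncomputable section

namespace Summit.ValiantsHypothesis.ValiantsHypothesis.Theorems.GeneratorObstructions.PerGenDegreeSuperQP

open Literature.NumberTheory.DiophantineGeometry Literature.Computability.AlgebraicComplexity
  Literature.Computability.Complexity

/-! ### 1. Weights: elementary bookkeeping -/

/-- A weight with nonpositive entries and size `0` is the zero weight. [folklore] -/
theorem weight_eq_zero_of_nonpos_of_size_eq_zero {σ : Type*} [Fintype σ] {χ : Weight σ}
    (hle : ∀ i, χ i ≤ 0) (hsize : χ.size = 0) : χ = 0 := by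
  funext i
  unfold Weight.size at hsize
  exact (Finset.sum_eq_zero_iff_of_nonpos (fun j _ => hle j)).mp hsize i (Finset.mem_univ i)

/-- The nonzero entries of a dominant (weakly decreasing) nonpositive weight form an UPPER set of
the index order: if `χ a ≠ 0` and `a ≤ b` then `χ b ≠ 0`. [folklore] -/
theorem apply_ne_zero_of_le_of_isDominant {σ : Type*} [Preorder σ] {χ : Weight σ}
    (hdom : χ.IsDominant) (hle : ∀ i, χ i ≤ 0) {a b : σ} (hab : a ≤ b) (ha : χ a ≠ 0) :
    χ b ≠ 0 := by
  exact (lt_of_le_of_lt (hdom hab) (lt_of_le_of_ne (hle a) ha)).ne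

/-- For two dominant nonpositive weights the sets of nonzero entries are NESTED (two upper sets of a
linear order are comparable). [folklore] -/
theorem filter_ne_zero_subset_or {σ : Type*} [Fintype σ] [LinearOrder σ] {χ ψ : Weight σ}
    (hχ : χ.IsDominant) (hχ0 : ∀ i, χ i ≤ 0) (hψ : ψ.IsDominant) (hψ0 : ∀ i, ψ i ≤ 0) :
    (Finset.univ.filter fun i => χ i ≠ 0) ⊆ (Finset.univ.filter fun i => ψ i ≠ 0) ∨
      (Finset.univ.filter fun i => ψ i ≠ 0) ⊆ (Finset.univ.filter fun i => χ i ≠ 0) := by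
  by_contra h
  rw [not_or, Finset.not_subset, Finset.not_subset] at h
  obtain ⟨⟨a, ha, haψ⟩, ⟨b, hb, hbχ⟩⟩ := h
  simp only [Finset.mem_filter, Finset.mem_univ, true_and, not_not] at ha hb haψ hbχ
  rcases le_total a b with hab | hba
  · exact apply_ne_zero_of_le_of_isDominant hχ hχ0 hab ha hbχ
  · exact apply_ne_zero_of_le_of_isDominant hψ hψ0 hba hb haψ

/-- Hence the number of nonzero entries of the SUM of two dominant nonpositive weights is the larger
of the two counts (in particular at most it). [folklore] -/
theorem card_filter_add_ne_zero_le_max {σ : Type*} [Fintype σ] [LinearOrder σ] {χ ψ : Weight σ}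
    (hχ : χ.IsDominant) (hχ0 : ∀ i, χ i ≤ 0) (hψ : ψ.IsDominant) (hψ0 : ∀ i, ψ i ≤ 0) :
    (Finset.univ.filter fun i => (χ + ψ) i ≠ 0).card ≤
      max (Finset.univ.filter fun i => χ i ≠ 0).card (Finset.univ.filter fun i => ψ i ≠ 0).card := by
  have hsub : (Finset.univ.filter fun i => (χ + ψ) i ≠ 0) ⊆
      (Finset.univ.filter fun i => χ i ≠ 0) ∪ (Finset.univ.filter fun i => ψ i ≠ 0) := by
    intro i hi
    simp only [Finset.mem_filter, Finset.mem_univ, true_and, Finset.mem_union, Pi.add_apply] at hi ⊢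
    by_contra h
    rw [not_or, not_not, not_not] at h
    exact hi (by rw [h.1, h.2, add_zero])
  rcases filter_ne_zero_subset_or hχ hχ0 hψ hψ0 with h | h
  · rw [Finset.union_eq_right.mpr h] at hsub
    exact (Finset.card_le_card hsub).trans (le_max_right _ _)
  · rw [Finset.union_eq_left.mpr h] at hsub
    exact (Finset.card_le_card hsub).trans (le_max_left _ _)

/-- The dual weight `λ^*` of a partition has at most `ℓ(λ)` nonzero entries (its nonzero entries
are `-λ_j` at the reversed positions `j < ℓ(λ)`). [folklore] -/
theorem card_filter_dualOfPartition_ne_zero_le {N s : ℕ} (lam : Nat.Partition s) :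
    (Finset.univ.filter fun i : Fin N => Weight.dualOfPartition N lam i ≠ 0).card ≤
      lam.parts.card := by
  classical
  calc (Finset.univ.filter fun i : Fin N => Weight.dualOfPartition N lam i ≠ 0).card
      ≤ (Finset.range lam.parts.card).card := by
        refine Finset.card_le_card_of_injOn (fun i : Fin N => ((Fin.rev i : Fin N) : ℕ)) ?_ ?_
        · intro i hi
          rw [Finset.mem_coe, Finset.mem_filter] at hi
          rw [Finset.mem_coe, Finset.mem_range]
          have hne := hi.2
          rw [Weight.dualOfPartition, Weight.dual, Weight.ofPartition_apply, neg_ne_zero,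
            Nat.cast_ne_zero] at hne
          by_contra hge
          rw [not_lt, ← Nat.Partition.length_sortedParts] at hge
          exact hne (List.getD_eq_default _ _ hge)
        · intro i _ j _ hij
          exact Fin.rev_injective (Fin.ext hij)
    _ = lam.parts.card := Finset.card_range _

/-! ### 2. Occurring weights of an orbit closure: length at most the degree -/

variable {m : ℕ}

/-- **`ℓ(λ) ≤ d` for occurring weights.** Let `f` be a form of degree `n ≠ 0` on the lexicographic
matrix variables `MatIdx m` and `χ` a weight OCCURRING in the coordinate ring `ℂ[Δ_n[f]]` of its
orbit closure (`HWV_χ ≠ ⊥`), of degree `D` (`|χ| = -n·D`). Then `χ` has at most `D` nonzero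
entries: `χ = λ^*` for a partition `λ ⊢ D·n` (BLMW (5.2.2),
`exists_eq_dualOfPartition_of_hasHighestWeight_orbitCoordRep_of_size_eq`), `χ` lifts to
`ℂ[Sym^n]` (`hasHighestWeight_coordRep_of_orbitCoordRep_holds`), and there `ℓ(λ) > d` forces
`HWV = ⊥` (Macdonald I.8 Ex. 9, the tree's `highestWeightSpace_coordRep_eq_bot_of_lt_card_parts`).
[cite: Macdonald1995, Ch. I §8 Example 9] -/
theorem card_filter_ne_zero_le_degree (f : MvPolynomial (MatIdx m) ℂ) {n D : ℕ} (hn : n ≠ 0)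
    (hf : f.IsHomogeneous n) {χ : Weight (MatIdx m)}
    (h : highestWeightSpace (orbitCoordRep f n) χ ≠ ⊥) (hD : χ.size = -((n * D : ℕ) : ℤ)) :
    (Finset.univ.filter fun x => χ x ≠ 0).card ≤ D := by
  classical
  haveI : Infinite ℂ := CharZero.infinite ℂ
  by_contra hlt
  rw [not_le] at hlt
  have h' : HasHighestWeight (orbitCoordRep f n) χ := h
  obtain ⟨lam, hlamN, hχ⟩ :=
    exists_eq_dualOfPartition_of_hasHighestWeight_orbitCoordRep_of_size_eq (matIdxEquiv m) f h' hD
  -- the support of `χ` has at most `ℓ(λ)` elements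
  have hsupp : (Finset.univ.filter fun x => χ x ≠ 0).card ≤ lam.parts.card := by
    have hcard : (Finset.univ.filter fun x => χ x ≠ 0).card =
        (Finset.univ.filter fun i : Fin (m * m) =>
          Weight.dualOfPartition (m * m) lam i ≠ 0).card := by
      refine (Finset.card_equiv (matIdxEquiv m).toEquiv ?_).symm
      intro i
      simp only [Finset.mem_filter, Finset.mem_univ, true_and, hχ]
      rw [RelIso.coe_fn_toEquiv, OrderIso.symm_apply_apply]
    rw [hcard]
    exact card_filter_dualOfPartition_ne_zero_le lam
  have hlen : D < lam.parts.card := lt_of_lt_of_le hlt hsupp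
  -- lift to `ℂ[Sym^n]` and apply the length vanishing theorem
  have hlift : HasHighestWeight (coordRep (MatIdx m) ℂ n) χ :=
    hasHighestWeight_coordRep_of_orbitCoordRep_holds f hn hf h'
  have hχ' : χ = partitionWeightLex m lam := hχ
  have hbot := highestWeightSpace_coordRep_eq_bot_of_lt_card_parts (k := ℂ)
    (strictAnti_revMatIdx m) (rfl : D * n = D * n) lam hlamN hlen
    (χ := χ) (fun i => by rw [hχ']; exact neg_partitionWeightLex_revMatIdx m lam i) hD
  exact hlift hbot


/-- **The first part of an occurring weight is at least the inner degree** (GIP Prop. 13, `λ₁ ≥ n`,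
the tree's `highestWeightSpace_coordRep_eq_bot_of_first_lt`, after the BLMW lift): for a form `f`
of degree `n ≠ 0` on `MatIdx m` (`m ≠ 0`) and a NONZERO weight `χ` occurring in `ℂ[Δ_n[f]]`, the
entry at the greatest matrix index satisfies `-χ(top) ≥ n`. [cite: GesmundoIkenmeyerPanova2017, Prop. 13] -/
theorem le_neg_apply_top_of_occurs [NeZero m] (f : MvPolynomial (MatIdx m) ℂ) {n : ℕ} (hn : n ≠ 0)
    (hf : f.IsHomogeneous n) {χ : Weight (MatIdx m)}
    (h : highestWeightSpace (orbitCoordRep f n) χ ≠ ⊥) (hχ0 : χ ≠ 0) :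
    (n : ℤ) ≤ -χ (topMatIdx m) := by
  classical
  haveI : Infinite ℂ := CharZero.infinite ℂ
  have h' : HasHighestWeight (orbitCoordRep f n) χ := h
  obtain ⟨hle, D, hD⟩ := nonpos_and_exists_size_eq_of_hasHighestWeight_orbitCoordRep f h'
  have hD0 : D ≠ 0 := by
    rintro rfl
    exact hχ0 (weight_eq_zero_of_nonpos_of_size_eq_zero hle (by simpa using hD))
  obtain ⟨lam, hlamN, hχ⟩ :=
    exists_eq_dualOfPartition_of_hasHighestWeight_orbitCoordRep_of_size_eq (matIdxEquiv m) f h' hD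
  have hχ' : χ = partitionWeightLex m lam := hχ
  -- `-χ(top) = λ₁`
  have htop : -χ (topMatIdx m) = ((lam.sortedParts.getD 0 0 : ℕ) : ℤ) := by
    have h0 := neg_partitionWeightLex_revMatIdx m lam 0
    rw [revMatIdx_zero, Weight.ofPartition_apply] at h0
    rw [hχ']
    exact h0
  rw [htop, Nat.cast_le]
  by_contra hlt
  rw [not_le] at hlt
  have hlift : HasHighestWeight (coordRep (MatIdx m) ℂ n) χ :=
    hasHighestWeight_coordRep_of_orbitCoordRep_holds f hn hf h'
  haveI : NeZero D := ⟨hD0⟩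
  have hbot := highestWeightSpace_coordRep_eq_bot_of_first_lt (k := ℂ)
    (strictAnti_revMatIdx m) lam hlamN hlt
    (χ := χ) (fun i => by rw [hχ']; exact neg_partitionWeightLex_revMatIdx m lam i) hD
  exact hlift hbot

/-! ### 3. Two atom certificates -/

/-- **Full-length certificate.** Let `f` be a form of degree `n ≠ 0` on `MatIdx m` and `χ` a
weight whose number of nonzero entries is AT LEAST its degree, `-|χ| ≤ n · #{x : χ x ≠ 0}`. Then
`χ` is an ATOM of the occurrence monoid of `ℂ[Δ_n[f]]`: it has no splitting `χ = χ₁ + χ₂` into two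
nonzero weights both occurring. Indeed occurring weights are dominant and nonpositive
(`isDominant_of_hasHighestWeight_orbitCoordRep`, `nonpos_and_exists_size_eq_…`), so the supports of
`χ₁, χ₂` are nested upper sets and `#supp(χ₁ + χ₂) = max ≤ max(d₁, d₂) < d₁ + d₂ = d(χ)` by
`ℓ ≤ d` (`card_filter_ne_zero_le_degree`). No occurrence hypothesis on `χ` itself is needed.
[cite: Macdonald1995, Ch. I §8 Example 9] -/
theorem atom_of_degree_le_card (f : MvPolynomial (MatIdx m) ℂ) {n : ℕ} (hn : n ≠ 0)
    (hf : f.IsHomogeneous n) {χ : Weight (MatIdx m)}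
    (hlen : -χ.size ≤ (n : ℤ) * (Finset.univ.filter fun x => χ x ≠ 0).card) :
    ∀ χ₁ χ₂ : Weight (MatIdx m), χ₁ + χ₂ = χ → χ₁ ≠ 0 → χ₂ ≠ 0 →
      highestWeightSpace (orbitCoordRep f n) χ₁ = ⊥ ∨
        highestWeightSpace (orbitCoordRep f n) χ₂ = ⊥ := by
  classical
  haveI : Infinite ℂ := CharZero.infinite ℂ
  intro χ₁ χ₂ hsum h1 h2
  by_contra hne
  rw [not_or] at hne
  obtain ⟨hne1, hne2⟩ := hne
  have h1' : HasHighestWeight (orbitCoordRep f n) χ₁ := hne1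
  have h2' : HasHighestWeight (orbitCoordRep f n) χ₂ := hne2
  obtain ⟨hle1, D₁, hD1⟩ := nonpos_and_exists_size_eq_of_hasHighestWeight_orbitCoordRep f h1'
  obtain ⟨hle2, D₂, hD2⟩ := nonpos_and_exists_size_eq_of_hasHighestWeight_orbitCoordRep f h2'
  have hdom1 := isDominant_of_hasHighestWeight_orbitCoordRep f h1'
  have hdom2 := isDominant_of_hasHighestWeight_orbitCoordRep f h2'
  have hD1pos : D₁ ≠ 0 := by
    rintro rfl
    exact h1 (weight_eq_zero_of_nonpos_of_size_eq_zero hle1 (by simpa using hD1))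
  have hD2pos : D₂ ≠ 0 := by
    rintro rfl
    exact h2 (weight_eq_zero_of_nonpos_of_size_eq_zero hle2 (by simpa using hD2))
  have hl1 := card_filter_ne_zero_le_degree f hn hf hne1 hD1
  have hl2 := card_filter_ne_zero_le_degree f hn hf hne2 hD2
  have hl := card_filter_add_ne_zero_le_max hdom1 hle1 hdom2 hle2
  rw [hsum] at hl
  -- sizes add
  have hsize : χ.size = χ₁.size + χ₂.size := by
    rw [← hsum]
    simp only [Weight.size, Pi.add_apply, Finset.sum_add_distrib]
  -- arithmetic
  set ℓ := (Finset.univ.filter fun x => χ x ≠ 0).card with hℓ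
  have key : n * (D₁ + D₂) ≤ n * ℓ := by
    have : (n : ℤ) * ((D₁ + D₂ : ℕ) : ℤ) ≤ (n : ℤ) * (ℓ : ℤ) := by
      rw [hsize, hD1, hD2] at hlen
      push_cast at hlen ⊢
      linarith
    exact_mod_cast this
  have key' : D₁ + D₂ ≤ ℓ := Nat.le_of_mul_le_mul_left key (Nat.pos_of_ne_zero hn)
  omega

/-- **First-row certificate.** Let `f` be a form of degree `n ≠ 0` on `MatIdx m` (`m ≠ 0`) and `χ`
a weight with `-χ(top) < 2n` at the greatest matrix index (first part `λ₁ < 2n`). Then `χ` is an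
atom of the occurrence monoid of `ℂ[Δ_n[f]]`: each nonzero occurring summand would contribute
`λ₁ ≥ n` (`le_neg_apply_top_of_occurs`, GIP Prop. 13). [cite: GesmundoIkenmeyerPanova2017, Prop. 13] -/
theorem atom_of_neg_apply_top_lt [NeZero m] (f : MvPolynomial (MatIdx m) ℂ) {n : ℕ} (hn : n ≠ 0)
    (hf : f.IsHomogeneous n) {χ : Weight (MatIdx m)} (htop : -χ (topMatIdx m) < 2 * (n : ℤ)) :
    ∀ χ₁ χ₂ : Weight (MatIdx m), χ₁ + χ₂ = χ → χ₁ ≠ 0 → χ₂ ≠ 0 →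
      highestWeightSpace (orbitCoordRep f n) χ₁ = ⊥ ∨
        highestWeightSpace (orbitCoordRep f n) χ₂ = ⊥ := by
  intro χ₁ χ₂ hsum h1 h2
  by_contra hne
  rw [not_or] at hne
  have e1 := le_neg_apply_top_of_occurs f hn hf hne.1 h1
  have e2 := le_neg_apply_top_of_occurs f hn hf hne.2 h2
  have : χ (topMatIdx m) = χ₁ (topMatIdx m) + χ₂ (topMatIdx m) := by rw [← hsum, Pi.add_apply]
  rw [this] at htop
  linarith

/-! ### 4. The honest cap: both certificates live at degree `< 2m²` -/

/-- **Cap of the full-length certificate**: a weight on `MatIdx m` has at most `m²` nonzero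
entries, so the full-length hypothesis `-|χ| ≤ n · #supp χ` forces degree `-|χ|/n ≤ m²`. [folklore] -/
theorem neg_size_le_of_degree_le_card {χ : Weight (MatIdx m)} {n : ℕ}
    (hlen : -χ.size ≤ (n : ℤ) * (Finset.univ.filter fun x => χ x ≠ 0).card) :
    -χ.size ≤ (n : ℤ) * (m * m : ℕ) := by
  refine hlen.trans (mul_le_mul_of_nonneg_left ?_ (Nat.cast_nonneg n))
  have h := Finset.card_le_univ (Finset.univ.filter fun x => χ x ≠ 0)
  rw [Fintype.card_lex, Fintype.card_prod, Fintype.card_fin] at h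
  exact_mod_cast h

/-- **Cap of the first-row certificate**: an occurring weight of `ℂ[Δ_n[f]]` with `-χ(top) < 2n`
has degree `< 2m²`, i.e. `-|χ| < 2n · m²` — it is `λ^*` with `|λ| ≤ λ₁ · ℓ(λ) < 2n · m²`
(dominant and nonpositive: every entry is `≥ χ(top)`). [folklore] -/
theorem neg_size_lt_of_neg_apply_top_lt [NeZero m] (f : MvPolynomial (MatIdx m) ℂ) {n : ℕ}
    {χ : Weight (MatIdx m)} (h : highestWeightSpace (orbitCoordRep f n) χ ≠ ⊥)
    (htop : -χ (topMatIdx m) < 2 * (n : ℤ)) :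
    -χ.size < 2 * (n : ℤ) * (m * m : ℕ) := by
  classical
  haveI : Infinite ℂ := CharZero.infinite ℂ
  have h' : HasHighestWeight (orbitCoordRep f n) χ := h
  have hdom := isDominant_of_hasHighestWeight_orbitCoordRep f h'
  -- every entry is at least `χ(top)`
  have hge : ∀ x, χ (topMatIdx m) ≤ χ x := fun x => hdom (le_topMatIdx m x)
  have hsum : -χ.size ≤ (m * m : ℕ) * (-χ (topMatIdx m)) := by
    unfold Weight.size
    rw [← Finset.sum_neg_distrib]
    have := Finset.sum_le_sum (s := Finset.univ) fun x (_ : x ∈ Finset.univ) => neg_le_neg (hge x)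
    refine this.trans ?_
    rw [Finset.sum_const, Finset.card_univ, Fintype.card_lex, Fintype.card_prod, Fintype.card_fin,
      nsmul_eq_mul]
  have hmm : (0 : ℤ) < (m * m : ℕ) := by
    have := NeZero.ne m
    positivity
  nlinarith

/-! ### 5. The permanent: the two clauses of `stub_atomLate` other than the degree clause -/

/-- `per_m` in the lexicographic matrix variables is a form of degree `m`. [folklore] -/
theorem perFormLex_isHomogeneous (m : ℕ) :
    (MvPolynomial.rename (toLex : Fin m × Fin m → MatIdx m) (perPoly (Fin m) ℂ)).IsHomogeneous m := by
  simpa [Fintype.card_fin] using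
    (perPoly_isHomogeneous (n := Fin m) (k := ℂ)).rename_isHomogeneous (f := toLex)

/-- `per_m` in the lexicographic matrix variables is nonzero (its value at the identity matrix is
`1`). [folklore] -/
theorem perFormLex_ne_zero (m : ℕ) :
    MvPolynomial.rename (toLex : Fin m × Fin m → MatIdx m) (perPoly (Fin m) ℂ) ≠ 0 := by
  intro h
  have hinj := MvPolynomial.rename_injective (R := ℂ) (toLex : Fin m × Fin m → MatIdx m)
    toLex.injective
  have h0 : perPoly (Fin m) ℂ = 0 := hinj (by rw [h, map_zero])
  have h1 := eval_perPoly (n := Fin m) (k := ℂ) (fun p => if p.1 = p.2 then 1 else 0)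
  rw [h0, map_zero, show (Matrix.of fun i j : Fin m => if i = j then (1 : ℂ) else 0) = 1 from by
    ext i j; simp [Matrix.one_apply], Matrix.permanent_one] at h1
  exact zero_ne_one h1

/-- **Full-length certificate for the permanent**, in the vocabulary of `stub_atomLate`: for
`1 ≤ m`, every weight `χ` of `GL_{m²}` with `-|χ| ≤ m · #supp χ` satisfies the ATOM clause of
`stub_atomLate` for `ℂ[Δ_m[per_m]]`. [cite: Macdonald1995, Ch. I §8 Example 9] -/
theorem per_atom_of_degree_le_card (hm : 1 ≤ m) {χ : Weight (MatIdx m)}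
    (hlen : -(Weight.size χ) ≤ (m : ℤ) * (Finset.univ.filter fun x => χ x ≠ 0).card) :
    ∀ χ₁ χ₂ : Weight (MatIdx m), χ₁ + χ₂ = χ → χ₁ ≠ 0 → χ₂ ≠ 0 →
      highestWeightSpace (orbitCoordRep (MvPolynomial.rename toLex (perPoly (Fin m) ℂ)) m) χ₁ = ⊥ ∨
        highestWeightSpace (orbitCoordRep (MvPolynomial.rename toLex (perPoly (Fin m) ℂ)) m) χ₂ = ⊥ :=
  atom_of_degree_le_card _ (by omega) (perFormLex_isHomogeneous m) hlen

/-- **First-row certificate for the permanent**, in the vocabulary of `stub_atomLate`: for `1 ≤ m`,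
every weight `χ` with `-χ(top) < 2m` satisfies the ATOM clause of `stub_atomLate` for
`ℂ[Δ_m[per_m]]`. [cite: GesmundoIkenmeyerPanova2017, Prop. 13] -/
theorem per_atom_of_neg_apply_top_lt (hm : 1 ≤ m) {χ : Weight (MatIdx m)}
    (htop : -χ (@topMatIdx m ⟨by omega⟩) < 2 * (m : ℤ)) :
    ∀ χ₁ χ₂ : Weight (MatIdx m), χ₁ + χ₂ = χ → χ₁ ≠ 0 → χ₂ ≠ 0 →
      highestWeightSpace (orbitCoordRep (MvPolynomial.rename toLex (perPoly (Fin m) ℂ)) m) χ₁ = ⊥ ∨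
        highestWeightSpace (orbitCoordRep (MvPolynomial.rename toLex (perPoly (Fin m) ℂ)) m) χ₂ = ⊥ :=
  haveI : NeZero m := ⟨by omega⟩
  atom_of_neg_apply_top_lt _ (by omega) (perFormLex_isHomogeneous m) htop

/-- **The degree-one atom.** For `1 ≤ m` the weight `-m·ε_top` (the class of the coordinate of
`x_top^m`, BIP §6(a)) OCCURS in `ℂ[Δ_m[per_m]]` (`hasHighestWeight_orbitCoordRep_single_top`) and
is an ATOM (full-length certificate with `#supp = 1 = degree`): the occurrence clause and the atom
clause of `stub_atomLate` are jointly satisfiable at every `m` — in degree `-|χ|/m = 1`. The whole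
content of `stub_atomLate` is therefore its DEGREE clause. [cite: BurgisserIkenmeyerPanovaJAMS2019, §6(a)] -/
theorem per_exists_atom_degree_one (hm : 1 ≤ m) :
    ∃ χ : Weight (MatIdx m),
      highestWeightSpace (orbitCoordRep (MvPolynomial.rename toLex (perPoly (Fin m) ℂ)) m) χ ≠ ⊥ ∧
      (∀ χ₁ χ₂ : Weight (MatIdx m), χ₁ + χ₂ = χ → χ₁ ≠ 0 → χ₂ ≠ 0 →
          highestWeightSpace (orbitCoordRep (MvPolynomial.rename toLex (perPoly (Fin m) ℂ)) m) χ₁ = ⊥ ∨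
            highestWeightSpace (orbitCoordRep (MvPolynomial.rename toLex (perPoly (Fin m) ℂ)) m) χ₂ = ⊥) ∧
      -(Weight.size χ) = m := by
  classical
  haveI : NeZero m := ⟨by omega⟩
  haveI : Infinite ℂ := CharZero.infinite ℂ
  refine ⟨Pi.single (topMatIdx m) (-(m : ℤ)), ?_, ?_, ?_⟩
  · exact hasHighestWeight_orbitCoordRep_single_top (perFormLex_isHomogeneous m)
      (perFormLex_ne_zero m) (topMatIdx m) (le_topMatIdx m)
  · refine per_atom_of_degree_le_card hm ?_
    have hsize : Weight.size (Pi.single (topMatIdx m) (-(m : ℤ)) : Weight (MatIdx m)) = -(m : ℤ) := by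
      unfold Weight.size
      rw [Finset.sum_pi_single']
      simp
    have hcard : (Finset.univ.filter fun x =>
        (Pi.single (topMatIdx m) (-(m : ℤ)) : Weight (MatIdx m)) x ≠ 0).card = 1 := by
      rw [Finset.card_eq_one]
      refine ⟨topMatIdx m, ?_⟩
      ext x
      simp only [Finset.mem_filter, Finset.mem_univ, true_and, Finset.mem_singleton]
      by_cases hx : x = topMatIdx m
      · subst hx
        simp [NeZero.ne m]
      · simp [hx]
    rw [hsize, hcard, neg_neg]
    simp
  · unfold Weight.size
    rw [Finset.sum_pi_single']
    simp

end Summit.ValiantsHypothesis.ValiantsHypothesis.Theorems.GeneratorObstructions.PerGenDegreeSuperQP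

end
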